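import Summits.Langlands.Langlands.Statement
import Literature.NumberTheory.Automorphic.IsAutomorphicAE
import Literature.NumberTheory.GaloisRepresentations.LabelledHodgeTateWeights
import Literature.NumberTheory.GaloisRepresentations.CrystallineDeformationRing
import Literature.NumberTheory.PAdicHodge.FontaineDpst
import HarnessLib

/-!
# `LevelOneNarrowBeyondFontaine_onpath` — F4 on-path lander: `Langlands → LevelOneNarrowBeyondFontaine`
# (the RUNG decl of record lives in this file)
# (G4 ladder-down generation 13 on `ReciprocityUpToIrreducibility`, item stmt-Langlands-14328)

DIAL (new, orthogonal to generations 1–12): the HODGE–TATE WIDTH `w` of clause (B) of the summit on the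
LEVEL-ONE sector over `ℚ` at the prime `ℓ = 7` — continuous irreducible `ρ : Γ_ℚ → GL_n(ℚ̄_7)`, `n ≥ 2`,
unramified at every finite place `v ≠ (7)`, crystalline at `(7)` for Fontaine's PINNED datum, all labelled
Hodge–Tate weights in a window of length `≤ w`.  FLOOR `w = 3`: Fontaine 1993 Prop. 1 (as quoted in
Fontaine–Mazur 1995 §3, Example after Conj. 2a): the set `Geom(ℚ, {7}, I_7, h; ℚ̄_7)` is EMPTY for every
Hodge–Tate type `h` of width `≤ 3` except the one-dimensional `ℚ̄_7(i)` — so clause (B) holds on the floor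
sector because its hypothesis set is empty in dimension `≥ 2`.  RUNG `w = 4`: the first cell beyond
Fontaine's proposition = the width-4 cell of Fontaine–Mazur's finiteness Conjecture 2a / of
Bergström–Faber's Conjecture 3 (level-one geometric Galois representations of motivic weight ≤ 22 are the
eleven Chenevier–Lannes ones): OPEN — unconditional Odlyzko bounds stop at root discriminant 22.2 <
7^(1+4/6) = 25.6, and no automorphy theorem over `ℚ` covers irregular or non-self-dual level-one `ρ` in
dimension ≥ 3.
-/

noncomputable section

set_option linter.dupNamespace false

open scoped MatrixGroups Matrix NumberField Classical
open NumberField IsDedekindDomain Field Filter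
open Literature.NumberTheory.Automorphic Literature.NumberTheory.GaloisRepresentations
open Literature.NumberTheory.PAdicHodge
open Summit.Langlands

namespace Summit.Langlands.Langlands.Cruxes.ReciprocityUpToIrreducibility.LevelOneNarrowBeyondFontaine

/-! ## The sector clauses -/

/-- **Level one away from `ℓ`**: `ρ` is unramified at every finite place `v` with `ℓ ∉ v`
(conductor one outside `ℓ`; Fontaine–Mazur's `G_{ℚ,S}`, `S = {ℓ}`). -/
def LevelOneAwayFrom {n : ℕ} (ℓ : ℕ) [Fact ℓ.Prime] (ρ : FramedGaloisRep ℚ (PadicAlgCl ℓ) n) : Prop :=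
  ∀ v : HeightOneSpectrum (𝓞 ℚ), ((ℓ : ℕ) : 𝓞 ℚ) ∉ v.asIdeal → ρ.IsUnramifiedAt v

/-- **Crystalline at `ℓ` with all labelled Hodge–Tate weights in a window of length `≤ w`**, for
Fontaine's PINNED datum `fontainePstAdicCompletion v ℓ hv` (= the summit's `ReciprocityData.pst`, by
`rfl`): Fontaine–Mazur's "`𝔏_ℓ = I_ℓ` and `h_r h_s ≠ 0 ⇒ s - r ≤ w`" (print: semistable at `ℓ`; rendered
with the formally STRONGER hypothesis crystalline, so every rendered statement below is implied by its
printed counterpart on the floor). -/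
def CrystallineNarrowAt {n : ℕ} (ℓ : ℕ) [Fact ℓ.Prime] (w : ℕ) (ρ : FramedGaloisRep ℚ (PadicAlgCl ℓ) n) :
    Prop :=
  ∀ (v : HeightOneSpectrum (𝓞 ℚ)) (hv : ((ℓ : ℕ) : 𝓞 ℚ) ∈ v.asIdeal),
    (fontainePstAdicCompletion v ℓ hv).IsCrystallineFramed (ρ.toLocal v) ∧
    ∀ τ : v.adicCompletion ℚ →+* PadicAlgCl ℓ, Continuous τ →
      ∀ a ∈ ρ.labelledHodgeTateWeightsAt v (fontainePstAdicCompletion v ℓ hv).algebra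
          (fontainePstAdicCompletion v ℓ hv).𝔅 τ,
      ∀ b ∈ ρ.labelledHodgeTateWeightsAt v (fontainePstAdicCompletion v ℓ hv).algebra
          (fontainePstAdicCompletion v ℓ hv).𝔅 τ,
        b - a ≤ (w : ℤ)

/-! ## The family and the rung -/

/-- **The rung family** `E(w)` — Hodge–Tate WIDTH `w` of clause (B) on the level-one sector over `ℚ`
at `ℓ = 7`: for every `n ≥ 2`, every `ι : ℚ̄_7 ≃ ℂ` and every continuous IRREDUCIBLE
`ρ : Γ_ℚ → GL_n(ℚ̄_7)` unramified at all finite `v ≠ (7)` and crystalline at `(7)` with all labelled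
Hodge–Tate weights in a window of length `≤ w`, there is an L-algebraic cuspidal automorphic
representation `π` of `GL_n(𝔸_ℚ)` attached to `ρ` at almost all places (`SatakeFrobCompatibleAE`).
`w ≤ 3`: KNOWN (vacuously: Fontaine 1993 Prop. 1 — no such `ρ`); `w = 4`: THE RUNG (open; expected
vacuous by Fontaine–Mazur Conj. 2a / Bergström–Faber Conj. 3 + Chenevier–Lannes: no level-one cuspidal
algebraic `π` of motivic weight `1 … 10`); `w ≥ 11`: non-vacuous (Δ, Sym²Δ, the level-one Siegel
forms …), open in dimension ≥ 3 beyond the self-dual regular cells.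
[cite: FontaineMazurGeometric1995, §3 Example after Conj. 2a (= Fontaine 1993, Prop. 1)] -/
def LevelOneNarrow (w : ℕ) : Prop :=
  ∀ (ℓ : ℕ) [Fact ℓ.Prime], ℓ = 7 →
    ∀ (n : ℕ) (hcpt : isCompact_glFiniteIntegralLevel n ℚ), 2 ≤ n →
    ∀ (ι : PadicAlgCl ℓ ≃+* ℂ) (ρ : FramedGaloisRep ℚ (PadicAlgCl ℓ) n),
      ρ.toGaloisRep.IsIrreducible →
      LevelOneAwayFrom ℓ ρ →
      CrystallineNarrowAt ℓ w ρ →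
      ∃ π : CuspidalAutomorphicRepData n ℚ hcpt, π.1.IsLAlgebraic ∧ SatakeFrobCompatibleAE ι π.1 ρ

/-- **THE RUNG** (the filed statement): the family at width `w = 4` — clause (B) of the summit for
irreducible level-one crystalline `ρ : Γ_ℚ → GL_n(ℚ̄_7)`, `n ≥ 2`, of Hodge–Tate width `≤ 4`: the first
cell of Fontaine–Mazur's Conjecture 2a at `(K, S, ℓ) = (ℚ, {7}, 7)` beyond Fontaine's Proposition 1. -/
def LevelOneNarrowBeyondFontaine : Prop := LevelOneNarrow 4

/-! ## Dial monotonicity -/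

theorem crystallineNarrowAt_mono {n : ℕ} {ℓ : ℕ} [Fact ℓ.Prime] {w w' : ℕ} (hle : w ≤ w')
    {ρ : FramedGaloisRep ℚ (PadicAlgCl ℓ) n} (h : CrystallineNarrowAt ℓ w ρ) :
    CrystallineNarrowAt ℓ w' ρ := by
  intro v hv
  obtain ⟨hcr, hwin⟩ := h v hv
  refine ⟨hcr, fun τ hτ a ha b hb => ?_⟩
  have := hwin τ hτ a ha b hb
  have hle' : (w : ℤ) ≤ (w' : ℤ) := by exact_mod_cast hle
  omega

/-- The dial is monotone: a wider rung implies every narrower one. -/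
theorem mono {w w' : ℕ} (hle : w ≤ w') (h : LevelOneNarrow w') : LevelOneNarrow w := by
  intro ℓ _ hℓ n hcpt hn ι ρ hirr hlev hcr
  exact h ℓ hℓ n hcpt hn ι ρ hirr hlev (crystallineNarrowAt_mono hle hcr)

theorem mono_four_three (h : LevelOneNarrowBeyondFontaine) : LevelOneNarrow 3 := mono (by norm_num) h

theorem mono_five_four (h : LevelOneNarrow 5) : LevelOneNarrowBeyondFontaine := mono (by norm_num) h

/-! ## On-path: the summit implies every rung -/

/-- Level one away from `ℓ` ⇒ unramified at all but finitely many places (only the place `(ℓ)` can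
ramify; the primes dividing `(ℓ) ≠ 0` are finitely many). -/
theorem eventually_isUnramifiedAt_of_levelOne {n : ℕ} {ℓ : ℕ} [Fact ℓ.Prime]
    {ρ : FramedGaloisRep ℚ (PadicAlgCl ℓ) n} (h : LevelOneAwayFrom ℓ ρ) :
    ∀ᶠ v : HeightOneSpectrum (𝓞 ℚ) in cofinite, ρ.IsUnramifiedAt v := by
  have hne : (Ideal.span {((ℓ : ℕ) : 𝓞 ℚ)} : Ideal (𝓞 ℚ)) ≠ 0 := by
    rw [Submodule.zero_eq_bot, Ne, Ideal.span_singleton_eq_bot]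
    exact_mod_cast (Fact.out : ℓ.Prime).ne_zero
  refine Filter.eventually_cofinite.2 ((Ideal.finite_factors hne).subset ?_)
  intro v hv
  show v.asIdeal ∣ Ideal.span {((ℓ : ℕ) : 𝓞 ℚ)}
  rw [Ideal.dvd_span_singleton]
  by_contra hmem
  exact hv (h v hmem)

/-- **ON-PATH** (F4): `Langlands → E(w)` for EVERY `w`: clause (B) of the summit at any reciprocity
datum of `ℚ` (one exists by the `Nonempty` conjunct) applies to every `ρ` of the sector — crystalline at
`(7)` for the PINNED datum `fontainePstAdicCompletion v 7 hv = Rec.pst 7 v hv` (`rfl`) gives de Rham there,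
level one gives a.e. unramified, so `IsGeometricFramed Rec ρ`; `Corresponds Rec ι π ρ` contains the
a.e. Satake–Frobenius clause as its first conjunct.  The width is not used. -/
theorem levelOneNarrow_of_langlands (w : ℕ) (hL : _root_.Langlands) : LevelOneNarrow w := by
  intro ℓ _ _hℓ n hcpt hn ι ρ hirr hlev hcr
  obtain ⟨⟨Rec⟩, hall⟩ := hL ℚ
  have hB : GaloisToAutomorphic n Rec hcpt := (hall Rec n (by omega) hcpt).2
  have hdR : ∀ (v : HeightOneSpectrum (𝓞 ℚ)) (hv : ((ℓ : ℕ) : 𝓞 ℚ) ∈ v.asIdeal),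
      (Rec.pst ℓ v hv).IsDeRhamFramed (ρ.toLocal v) := by
    intro v hv
    change (fontainePstAdicCompletion v ℓ hv).IsDeRhamFramed (ρ.toLocal v)
    exact (hcr v hv).1.isDeRhamFramed
  have hgeo : IsGeometricFramed Rec ρ := ⟨eventually_isUnramifiedAt_of_levelOne hlev, hdR⟩
  obtain ⟨π, hπL, hcorr⟩ := hB ℓ ι ρ hirr hgeo
  refine ⟨π, hπL, ?_⟩
  filter_upwards [hcorr.1] with v hv
  exact hv

/-- **F4 on-path lemma for the rung**: `Langlands → LevelOneNarrowBeyondFontaine`. -/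
@[aesop safe apply]
theorem LevelOneNarrowBeyondFontaine_of_Langlands (hL : _root_.Langlands) :
    LevelOneNarrowBeyondFontaine :=
  levelOneNarrow_of_langlands 4 hL

example : _root_.Langlands → LevelOneNarrowBeyondFontaine := by intro h; aesop

end Summit.Langlands.Langlands.Cruxes.ReciprocityUpToIrreducibility.LevelOneNarrowBeyondFontaine

end
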